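import Literature.MathematicalPhysics.QuantumFieldTheory.Balaban1983to89.T3UnitScaleTilt
import Literature.MathematicalPhysics.QuantumFieldTheory.Balaban1983to89.T3UnitLawDensityEML
import Literature.MathematicalPhysics.QuantumFieldTheory.Balaban1983to89.WilsonLoopLimit
import Literature.MathematicalPhysics.QuantumFieldTheory.Balaban1983to89.T4PairDerivBridge

/-!
# Route `RandomisedStokes` (LINE 18 of ideator ym-r3-idea-2 on crux stmt-QuantumFields-19936 `UnitScaleTilt.HistoryTailL`):
# the OFF-SLIVER PER-PLAQUETTE BOUND of the glue `HistoryTailOfChaosL` (stmt-QuantumFields-23887) — engine, part 1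

For one family `F`, one coupling `0 < γ ≤ 1`, one run `K`, one averaged level `j ≤ K` and one level-`j` plaquette `q`, the Gibbs mass of
the large-plaquette event `{θ ≤ dist1(Ū^j(∂q))}` (`0 < θ ≤ 2`) is bounded by
`#(rectangle labels) · TailR(η) + TailX(η)`, `η = θ/(2D(j+1))`, where
* `TailX(η) = C_X β_K^{A_X} exp(−(c_X η/(γL^{−(K−j)}))^{α_X})` is the CHAOS hypothesis (item `ChaosSuppressedDominationL`, stated structurally)
  applied to `{profile-flat(η) ∧ D(j+1)η < dist1}`;
* `{¬ profile-flat(η)}` is a union over the rectangle labels `(i, a, b, x, μ, ν) ∈ Fin (j+1) × Fin (⌊RL^j⌋₊+1)² × sites × directions²`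
  of one-rectangle tail events, each bounded — uniformly in the label — by
  `TailR(η) = C_R β_K^{A_R} (RL^j)^{A_R} exp(−(c_R η²β_K/(RL^j(1+log(RL^j))))^{α_R})` from the RECTANGLE TAIL hypothesis (item `RectangleTailL`,
  stated structurally) at `t = η√(L^i/L^j)` (`(a+b) ≤ RL^i` makes the exponent label-free).
For `θ > 2` the event is empty (`dist1 ≤ 2` on `SU(2)`).

Pure bookkeeping (set inclusions, a finite union bound, monotonicity of the printed tail shapes); the two hypotheses are the route's OPEN
cruxes and are NOT proved here.  No crux, no rung (R3 `YM3TorusSU2` is a RECORD rung) and no summit is proved; the Yang–Mills mass gap is NOT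
proved by any of this.  Cell `ym-idea-1`, LEAD seat `ym-line-sfw-p2` g71 (free hands), `--supports stmt-QuantumFields-23887`.
References: T. Bałaban, CMP 102 (1985) 255–275 [Balaban1985UV3] ((7) p.257); S. Chatterjee, *Yang–Mills for probabilists* [ChatterjeeYMProb2019] §4–5.
-/

set_option autoImplicit false

noncomputable section

open MeasureTheory Filter Topology
open Literature.MathematicalPhysics.QuantumFieldTheory.Balaban1983to89
open Literature.MathematicalPhysics.QuantumFieldTheory.Balaban1983to89.Missing
open Literature.MathematicalPhysics.QuantumFieldTheory.Balaban1983to89.T3ContinuumYM3Torus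
open Literature.MathematicalPhysics.QuantumFieldTheory.Balaban1983to89.T3UnitScaleTilt
open Literature.MathematicalPhysics.QuantumFieldTheory.Balaban1983to89.T3UnitLawDensityEML (ℰp)

namespace Summit.QuantumFields.YangMills.Theorems.RandomisedStokesOffSliver

variable (F : T3Family) (γ : ℝ)

/-! ## §1 The rectangle labels and their count -/

/-- Number of sites of the finest lattice: `(sites per direction)^3`. [folklore] -/
theorem card_site_zero (K : ℕ) : Fintype.card (Site (F.P K) 0) = ((F.P K).sitesPerDir 0) ^ 3 := by
  rw [show Fintype.card (Site (F.P K) 0) = Fintype.card (Fin (F.P K).d → ZMod ((F.P K).sitesPerDir 0)) from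
    Fintype.card_congr (Equiv.refl _), Fintype.card_fun, ZMod.card, Fintype.card_fin, T3Family.P_d]

/-- The rectangle-label type of level `j` with side bound `Amax`: `(i, a, b, x, μ, ν)`. Its cardinality is
`(j+1)(Amax+1)²·(sitesPerDir 0)³·9`. [folklore] -/
theorem card_labels (K j Amax : ℕ) :
    (Fintype.card (Fin (j + 1) × Fin (Amax + 1) × Fin (Amax + 1) × Site (F.P K) 0 × Fin (F.P K).d × Fin (F.P K).d) : ℝ) =
      ((j : ℝ) + 1) * ((Amax : ℝ) + 1) ^ 2 * (((F.P K).sitesPerDir 0 : ℝ)) ^ 3 * 9 := by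
  rw [Fintype.card_prod, Fintype.card_prod, Fintype.card_prod, Fintype.card_prod, Fintype.card_prod, Fintype.card_fin,
    Fintype.card_fin, Fintype.card_fin, card_site_zero, T3Family.P_d]
  push_cast
  ring

/-! ## §2 One rectangle: the label-uniform tail -/

variable {F γ}

/-- `1 ≤ L^i ≤ L^j` bookkeeping: for `i ≤ j` and `1 ≤ L`, `√(L^i/L^j) ≤ 1` and `0 < √(L^i/L^j)`. [folklore] -/
theorem sqrt_ratio_pos_le_one {L : ℕ} (hL : 1 ≤ L) {i j : ℕ} (hij : i ≤ j) :
    0 < Real.sqrt (((L : ℝ)) ^ i / ((L : ℝ)) ^ j) ∧ Real.sqrt (((L : ℝ)) ^ i / ((L : ℝ)) ^ j) ≤ 1 := by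
  have hL1 : (1 : ℝ) ≤ L := by exact_mod_cast hL
  have hLi : (0 : ℝ) < (L : ℝ) ^ i := pow_pos (by linarith) i
  have hLj : (0 : ℝ) < (L : ℝ) ^ j := pow_pos (by linarith) j
  have hle : (L : ℝ) ^ i ≤ (L : ℝ) ^ j := pow_le_pow_right₀ hL1 hij
  refine ⟨Real.sqrt_pos.mpr (div_pos hLi hLj), Real.sqrt_le_one.mpr ((div_le_one hLj).mpr hle)⟩

/-- **THE LABEL-UNIFORM EXPONENT**: for a rectangle with `1 ≤ a`, `1 ≤ b`, `(a+b) ≤ R·L^i`, `i ≤ j`, `L ≥ 1`, `R ≥ 2`, and `t = η√(L^i/L^j)`,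
`η²β/(RL^j(1+log(RL^j))) ≤ t²β/((a+b)(1+log(a+b)))` (`β ≥ 0`). [folklore] -/
theorem ratio_ge_uniform {L : ℕ} (hL : 1 ≤ L) {i j a b : ℕ} (hij : i ≤ j) (ha : 1 ≤ a) (hb : 1 ≤ b) {R η β : ℝ}
    (hR : 2 ≤ R) (hβ : 0 ≤ β) (hab : ((a : ℝ) + b) ≤ R * (L : ℝ) ^ i) :
    η ^ 2 * β / (R * (L : ℝ) ^ j * (1 + Real.log (R * (L : ℝ) ^ j))) ≤
      (η * Real.sqrt ((L : ℝ) ^ i / (L : ℝ) ^ j)) ^ 2 * β / (((a : ℝ) + b) * (1 + Real.log ((a : ℝ) + b))) := by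
  have hL1 : (1 : ℝ) ≤ L := by exact_mod_cast hL
  have hLi : (1 : ℝ) ≤ (L : ℝ) ^ i := one_le_pow₀ hL1
  have hLj0 : (0 : ℝ) < (L : ℝ) ^ j := pow_pos (by linarith) j
  have hLi0 : (0 : ℝ) < (L : ℝ) ^ i := by linarith
  have hle : (L : ℝ) ^ i ≤ (L : ℝ) ^ j := pow_le_pow_right₀ hL1 hij
  have hab2 : (2 : ℝ) ≤ (a : ℝ) + b := by exact_mod_cast (show 2 ≤ a + b by omega)
  have hab0 : (0 : ℝ) < (a : ℝ) + b := by linarith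
  have hRLj : (a : ℝ) + b ≤ R * (L : ℝ) ^ j := hab.trans (mul_le_mul_of_nonneg_left hle (by linarith))
  have hRLj0 : 0 < R * (L : ℝ) ^ j := hab0.trans_le hRLj
  have hlog1 : 0 ≤ Real.log ((a : ℝ) + b) := Real.log_nonneg (by linarith)
  have hlog2 : Real.log ((a : ℝ) + b) ≤ Real.log (R * (L : ℝ) ^ j) := Real.log_le_log hab0 hRLj
  have hden1 : 0 < ((a : ℝ) + b) * (1 + Real.log ((a : ℝ) + b)) := mul_pos hab0 (by linarith)
  have hden2 : 0 < R * (L : ℝ) ^ j * (1 + Real.log (R * (L : ℝ) ^ j)) := mul_pos hRLj0 (by linarith)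
  have hsq : Real.sqrt ((L : ℝ) ^ i / (L : ℝ) ^ j) ^ 2 = (L : ℝ) ^ i / (L : ℝ) ^ j :=
    Real.sq_sqrt (div_nonneg hLi0.le hLj0.le)
  rw [mul_pow, hsq, div_le_div_iff₀ hden2 hden1]
  -- `η²β · ((a+b)(1+log(a+b))) ≤ η² (L^i/L^j) β · (R L^j (1 + log (R L^j)))`
  have hη2 : 0 ≤ η ^ 2 * β := mul_nonneg (sq_nonneg η) hβ
  have hkey : ((a : ℝ) + b) * (1 + Real.log ((a : ℝ) + b)) ≤
      (L : ℝ) ^ i / (L : ℝ) ^ j * (R * (L : ℝ) ^ j * (1 + Real.log (R * (L : ℝ) ^ j))) := by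
    have h1 : (L : ℝ) ^ i / (L : ℝ) ^ j * (R * (L : ℝ) ^ j * (1 + Real.log (R * (L : ℝ) ^ j))) =
        R * (L : ℝ) ^ i * (1 + Real.log (R * (L : ℝ) ^ j)) := by
      field_simp
    rw [h1]
    exact mul_le_mul hab (by linarith) (by linarith) (by positivity)
  calc η ^ 2 * β * (((a : ℝ) + b) * (1 + Real.log ((a : ℝ) + b)))
      ≤ η ^ 2 * β * ((L : ℝ) ^ i / (L : ℝ) ^ j * (R * (L : ℝ) ^ j * (1 + Real.log (R * (L : ℝ) ^ j)))) :=
        mul_le_mul_of_nonneg_left hkey hη2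
    _ = η ^ 2 * ((L : ℝ) ^ i / (L : ℝ) ^ j) * β * (R * (L : ℝ) ^ j * (1 + Real.log (R * (L : ℝ) ^ j))) := by ring

/-- **ONE RECTANGLE LABEL** (`0 < γ ≤ 1`, `R ≥ 2`, `0 < η ≤ 1`, `j ≤ K`): under the RECTANGLE TAIL hypothesis of the route (constants
`α_R, c_R, C_R, A_R`, stated structurally for the family `F` at coupling `γ`), the event «the label is admissible AND its rectangle holonomy is
`> η√(L^i/L^j)` from `1`» has Gibbs mass `≤ C_R β_K^{A_R} (RL^j)^{A_R} exp(−(c_R η²β_K/(RL^j(1+log(RL^j))))^{α_R})`, uniformly in the label.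
[cite: ChatterjeeYMProb2019, §5 Problem 5.2] -/
theorem rect_label_le (hγ : 0 < γ) {R αR cR CR : ℝ} {AR : ℕ} (hR : 2 ≤ R) (hαR : 0 < αR) (hcR : 0 < cR) (hCR : 0 ≤ CR)
    (hRR : ∀ (K a b : ℕ) (x : Site (F.P K) 0) (μ ν : Fin (F.P K).d) (t : ℝ), μ ≠ ν → 1 ≤ a → 1 ≤ b →
      2 * (a + b) < (F.P K).sitesPerDir 0 → 0 < t → t ≤ 1 →
        (gibbsK F ℰp γ K).real {U | t ≤ GaugeGroup.dist1 (Missing.pathHol U (Missing.rectLoop x μ ν a b))} ≤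
          CR * (F.scheme ℰp γ).β K ^ AR * ((a : ℝ) + b) ^ AR *
            Real.exp (-((cR * (t ^ 2 * (F.scheme ℰp γ).β K / (((a : ℝ) + b) * (1 + Real.log ((a : ℝ) + b))))) ^ αR)))
    (K j : ℕ) {η : ℝ} (hη : 0 < η) (hη1 : η ≤ 1) (i a b : ℕ) (x : Site (F.P K) 0) (μ ν : Fin (F.P K).d) :
    (gibbsK F ℰp γ K).real {U | (μ ≠ ν ∧ i ≤ j ∧ 1 ≤ a ∧ 1 ≤ b ∧ 2 * (a + b) < (F.P K).sitesPerDir 0 ∧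
        ((a : ℝ) + b) ≤ R * (F.L : ℝ) ^ i) ∧
        η * Real.sqrt ((F.L : ℝ) ^ i / (F.L : ℝ) ^ j) < GaugeGroup.dist1 (Missing.pathHol U (Missing.rectLoop x μ ν a b))} ≤
      CR * (F.scheme ℰp γ).β K ^ AR * (R * (F.L : ℝ) ^ j) ^ AR *
        Real.exp (-((cR * (η ^ 2 * (F.scheme ℰp γ).β K / (R * (F.L : ℝ) ^ j * (1 + Real.log (R * (F.L : ℝ) ^ j))))) ^ αR)) := by
  haveI := isProbabilityMeasure_gibbsK F ℰp hγ.le K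
  have hL : 1 ≤ F.L := F.hL.2.le
  have hL1 : (1 : ℝ) ≤ F.L := by exact_mod_cast hL
  have hβ0 : 0 ≤ (F.scheme ℰp γ).β K := F.scheme_β_nonneg ℰp hγ.le K
  have hRHS0 : 0 ≤ CR * (F.scheme ℰp γ).β K ^ AR * (R * (F.L : ℝ) ^ j) ^ AR *
      Real.exp (-((cR * (η ^ 2 * (F.scheme ℰp γ).β K / (R * (F.L : ℝ) ^ j * (1 + Real.log (R * (F.L : ℝ) ^ j))))) ^ αR)) :=
    mul_nonneg (mul_nonneg (mul_nonneg hCR (pow_nonneg hβ0 AR)) (pow_nonneg (by positivity) AR)) (Real.exp_nonneg _)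
  by_cases hadm : μ ≠ ν ∧ i ≤ j ∧ 1 ≤ a ∧ 1 ≤ b ∧ 2 * (a + b) < (F.P K).sitesPerDir 0 ∧ ((a : ℝ) + b) ≤ R * (F.L : ℝ) ^ i
  · obtain ⟨hμν, hij, ha, hb, hsmall, hab⟩ := hadm
    obtain ⟨ht0, ht1⟩ := sqrt_ratio_pos_le_one hL hij
    set t : ℝ := η * Real.sqrt ((F.L : ℝ) ^ i / (F.L : ℝ) ^ j) with ht_def
    have htpos : 0 < t := mul_pos hη ht0
    have htle : t ≤ 1 := by
      calc t ≤ 1 * 1 := mul_le_mul hη1 ht1 ht0.le zero_le_one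
        _ = 1 := one_mul 1
    have hsub : {U : GaugeField (F.P K) 0 (Matrix.specialUnitaryGroup (Fin 2) ℂ) |
        (μ ≠ ν ∧ i ≤ j ∧ 1 ≤ a ∧ 1 ≤ b ∧ 2 * (a + b) < (F.P K).sitesPerDir 0 ∧ ((a : ℝ) + b) ≤ R * (F.L : ℝ) ^ i) ∧
          η * Real.sqrt ((F.L : ℝ) ^ i / (F.L : ℝ) ^ j) < GaugeGroup.dist1 (Missing.pathHol U (Missing.rectLoop x μ ν a b))} ⊆
        {U | t ≤ GaugeGroup.dist1 (Missing.pathHol U (Missing.rectLoop x μ ν a b))} := fun U hU => le_of_lt hU.2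
    refine (measureReal_mono hsub (measure_ne_top _ _)).trans ((hRR K a b x μ ν t hμν ha hb hsmall htpos htle).trans ?_)
    -- monotonicity in the label
    have hab2 : (2 : ℝ) ≤ (a : ℝ) + b := by exact_mod_cast (show 2 ≤ a + b by omega)
    have hle : (F.L : ℝ) ^ i ≤ (F.L : ℝ) ^ j := pow_le_pow_right₀ hL1 hij
    have hRLj : (a : ℝ) + b ≤ R * (F.L : ℝ) ^ j := hab.trans (mul_le_mul_of_nonneg_left hle (by linarith))
    have hpowA : ((a : ℝ) + b) ^ AR ≤ (R * (F.L : ℝ) ^ j) ^ AR := pow_le_pow_left₀ (by linarith) hRLj AR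
    have hratio := ratio_ge_uniform (η := η) hL hij ha hb hR hβ0 hab
    have hρ0 : 0 ≤ η ^ 2 * (F.scheme ℰp γ).β K / (R * (F.L : ℝ) ^ j * (1 + Real.log (R * (F.L : ℝ) ^ j))) := by
      have hRLj0 : 0 < R * (F.L : ℝ) ^ j := by linarith
      have hlog : 0 ≤ Real.log (R * (F.L : ℝ) ^ j) := Real.log_nonneg (by linarith)
      positivity
    have hexp : Real.exp (-((cR * (t ^ 2 * (F.scheme ℰp γ).β K / (((a : ℝ) + b) * (1 + Real.log ((a : ℝ) + b))))) ^ αR)) ≤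
        Real.exp (-((cR * (η ^ 2 * (F.scheme ℰp γ).β K / (R * (F.L : ℝ) ^ j * (1 + Real.log (R * (F.L : ℝ) ^ j))))) ^ αR)) := by
      refine Real.exp_le_exp.mpr (neg_le_neg (Real.rpow_le_rpow (by positivity) ?_ hαR.le))
      exact mul_le_mul_of_nonneg_left hratio hcR.le
    calc CR * (F.scheme ℰp γ).β K ^ AR * ((a : ℝ) + b) ^ AR *
          Real.exp (-((cR * (t ^ 2 * (F.scheme ℰp γ).β K / (((a : ℝ) + b) * (1 + Real.log ((a : ℝ) + b))))) ^ αR))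
        ≤ CR * (F.scheme ℰp γ).β K ^ AR * (R * (F.L : ℝ) ^ j) ^ AR *
          Real.exp (-((cR * (t ^ 2 * (F.scheme ℰp γ).β K / (((a : ℝ) + b) * (1 + Real.log ((a : ℝ) + b))))) ^ αR)) :=
          mul_le_mul_of_nonneg_right (mul_le_mul_of_nonneg_left hpowA (mul_nonneg hCR (pow_nonneg hβ0 AR))) (Real.exp_nonneg _)
      _ ≤ _ := mul_le_mul_of_nonneg_left hexp (mul_nonneg (mul_nonneg hCR (pow_nonneg hβ0 AR)) (pow_nonneg (by positivity) AR))
  · have hempty : {U : GaugeField (F.P K) 0 (Matrix.specialUnitaryGroup (Fin 2) ℂ) |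
        (μ ≠ ν ∧ i ≤ j ∧ 1 ≤ a ∧ 1 ≤ b ∧ 2 * (a + b) < (F.P K).sitesPerDir 0 ∧ ((a : ℝ) + b) ≤ R * (F.L : ℝ) ^ i) ∧
          η * Real.sqrt ((F.L : ℝ) ^ i / (F.L : ℝ) ^ j) < GaugeGroup.dist1 (Missing.pathHol U (Missing.rectLoop x μ ν a b))} = ∅ :=
      Set.eq_empty_of_forall_notMem fun U hU => hadm hU.1
    rw [hempty, measureReal_empty]
    exact hRHS0

/-! ## §3 The non-flat event: union over the labels -/

/-- **NOT PROFILE-FLAT ⇒ SOME ADMISSIBLE LABEL IS LARGE**: the complement of the multi-scale flatness event of the route (all contractible finest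
rectangles with `a+b ≤ R·L^i`, `i ≤ j`, within `η√(L^i/L^j)` of `1`) lies in the union over the finite label type
`Fin (j+1) × Fin (⌊RL^j⌋₊+1)² × sites × directions²` of the one-label events of `rect_label_le` (`R ≥ 0`, `L ≥ 1`). [folklore] -/
theorem not_flat_subset_iUnion {R : ℝ} (hR : 0 ≤ R) (K j : ℕ) (η : ℝ) :
    {U : GaugeField (F.P K) 0 (Matrix.specialUnitaryGroup (Fin 2) ℂ) |
        ¬ (∀ (i a b : ℕ) (x : Site (F.P K) 0) (μ ν : Fin (F.P K).d), μ ≠ ν → i ≤ j → 1 ≤ a → 1 ≤ b →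
          2 * (a + b) < (F.P K).sitesPerDir 0 → ((a : ℝ) + b) ≤ R * (F.L : ℝ) ^ i →
            GaugeGroup.dist1 (Missing.pathHol U (Missing.rectLoop x μ ν a b)) ≤ η * Real.sqrt ((F.L : ℝ) ^ i / (F.L : ℝ) ^ j))} ⊆
      ⋃ τ : Fin (j + 1) × Fin (⌊R * (F.L : ℝ) ^ j⌋₊ + 1) × Fin (⌊R * (F.L : ℝ) ^ j⌋₊ + 1) × Site (F.P K) 0 ×
          Fin (F.P K).d × Fin (F.P K).d,
        {U | ((τ.2.2.2.2.1 ≠ τ.2.2.2.2.2 ∧ (τ.1 : ℕ) ≤ j ∧ 1 ≤ (τ.2.1 : ℕ) ∧ 1 ≤ (τ.2.2.1 : ℕ) ∧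
              2 * ((τ.2.1 : ℕ) + (τ.2.2.1 : ℕ)) < (F.P K).sitesPerDir 0 ∧
                (((τ.2.1 : ℕ) : ℝ) + ((τ.2.2.1 : ℕ) : ℝ)) ≤ R * (F.L : ℝ) ^ (τ.1 : ℕ)) ∧
            η * Real.sqrt ((F.L : ℝ) ^ (τ.1 : ℕ) / (F.L : ℝ) ^ j) <
              GaugeGroup.dist1 (Missing.pathHol U (Missing.rectLoop τ.2.2.2.1 τ.2.2.2.2.1 τ.2.2.2.2.2 τ.2.1 τ.2.2.1)))} := by
  intro U hU
  simp only [Set.mem_setOf_eq, not_forall, not_le, exists_prop] at hU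
  obtain ⟨i, a, b, x, μ, ν, hμν, hij, ha, hb, hsmall, hab, hlt⟩ := hU
  have hL1 : (1 : ℝ) ≤ F.L := by exact_mod_cast F.hL.2.le
  have hle : (F.L : ℝ) ^ i ≤ (F.L : ℝ) ^ j := pow_le_pow_right₀ hL1 hij
  have hRLj : (a : ℝ) + b ≤ R * (F.L : ℝ) ^ j := hab.trans (mul_le_mul_of_nonneg_left hle hR)
  have haN : a ≤ ⌊R * (F.L : ℝ) ^ j⌋₊ := Nat.le_floor (by have : (0:ℝ) ≤ b := Nat.cast_nonneg b; linarith)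
  have hbN : b ≤ ⌊R * (F.L : ℝ) ^ j⌋₊ := Nat.le_floor (by have : (0:ℝ) ≤ a := Nat.cast_nonneg a; linarith)
  refine Set.mem_iUnion.mpr ⟨(⟨i, by omega⟩, ⟨a, by omega⟩, ⟨b, by omega⟩, x, μ, ν), ?_⟩
  exact ⟨⟨hμν, hij, ha, hb, hsmall, hab⟩, hlt⟩

/-- **THE NON-FLAT EVENT** (`0 < γ ≤ 1`, `R ≥ 2`, `0 < η ≤ 1`): under the RECTANGLE TAIL hypothesis, its Gibbs mass is at most
`(j+1)(⌊RL^j⌋₊+1)²(sitesPerDir 0)³·9 · C_R β_K^{A_R} (RL^j)^{A_R} exp(−(c_R η²β_K/(RL^j(1+log(RL^j))))^{α_R})`.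
[cite: ChatterjeeYMProb2019, §5 Problem 5.2] -/
theorem not_flat_le (hγ : 0 < γ) {R αR cR CR : ℝ} {AR : ℕ} (hR : 2 ≤ R) (hαR : 0 < αR) (hcR : 0 < cR) (hCR : 0 ≤ CR)
    (hRR : ∀ (K a b : ℕ) (x : Site (F.P K) 0) (μ ν : Fin (F.P K).d) (t : ℝ), μ ≠ ν → 1 ≤ a → 1 ≤ b →
      2 * (a + b) < (F.P K).sitesPerDir 0 → 0 < t → t ≤ 1 →
        (gibbsK F ℰp γ K).real {U | t ≤ GaugeGroup.dist1 (Missing.pathHol U (Missing.rectLoop x μ ν a b))} ≤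
          CR * (F.scheme ℰp γ).β K ^ AR * ((a : ℝ) + b) ^ AR *
            Real.exp (-((cR * (t ^ 2 * (F.scheme ℰp γ).β K / (((a : ℝ) + b) * (1 + Real.log ((a : ℝ) + b))))) ^ αR)))
    (K j : ℕ) {η : ℝ} (hη : 0 < η) (hη1 : η ≤ 1) :
    (gibbsK F ℰp γ K).real {U : GaugeField (F.P K) 0 (Matrix.specialUnitaryGroup (Fin 2) ℂ) |
        ¬ (∀ (i a b : ℕ) (x : Site (F.P K) 0) (μ ν : Fin (F.P K).d), μ ≠ ν → i ≤ j → 1 ≤ a → 1 ≤ b →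
          2 * (a + b) < (F.P K).sitesPerDir 0 → ((a : ℝ) + b) ≤ R * (F.L : ℝ) ^ i →
            GaugeGroup.dist1 (Missing.pathHol U (Missing.rectLoop x μ ν a b)) ≤ η * Real.sqrt ((F.L : ℝ) ^ i / (F.L : ℝ) ^ j))} ≤
      (((j : ℝ) + 1) * ((⌊R * (F.L : ℝ) ^ j⌋₊ : ℝ) + 1) ^ 2 * (((F.P K).sitesPerDir 0 : ℝ)) ^ 3 * 9) *
        (CR * (F.scheme ℰp γ).β K ^ AR * (R * (F.L : ℝ) ^ j) ^ AR *
          Real.exp (-((cR * (η ^ 2 * (F.scheme ℰp γ).β K / (R * (F.L : ℝ) ^ j * (1 + Real.log (R * (F.L : ℝ) ^ j))))) ^ αR))) := by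
  haveI := isProbabilityMeasure_gibbsK F ℰp hγ.le K
  refine (measureReal_mono (not_flat_subset_iUnion (by linarith) K j η) (measure_ne_top _ _)).trans ?_
  refine (measureReal_iUnion_fintype_le _).trans ?_
  rw [← card_labels F K j ⌊R * (F.L : ℝ) ^ j⌋₊, ← Finset.card_univ, ← nsmul_eq_mul, ← Finset.sum_const]
  exact Finset.sum_le_sum fun τ _ => rect_label_le hγ hR hαR hcR hCR hRR K j hη hη1 _ _ _ _ _ _

/-! ## §4 The per-plaquette off-sliver bound -/

/-- **THE OFF-SLIVER PER-PLAQUETTE BOUND** (`0 < γ ≤ 1`, `D ≥ 1`, `R ≥ 2`, `j ≤ K`, `θ > 0`): under the RECTANGLE TAIL and the CHAOS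
hypotheses of route `RandomisedStokes` (both stated structurally for `F` at `γ`), for every level-`j` plaquette `q`
`Gibbs_K{θ ≤ dist1(Ū^j(∂q))} ≤ #labels·TailR(η) + TailX(η)` with `η = θ/(2D(j+1))`: for `θ ≤ 2` one has `η ≤ 1`, the event lies in
`{¬flat(η)} ∪ {flat(η) ∧ D(j+1)η < dist1}` (`D(j+1)η = θ/2 < θ`), and the two pieces are `not_flat_le` and the chaos hypothesis; for
`θ > 2` the event is empty (`dist1 ≤ 2` on `SU(2)`, `T4PairDerivBridge.dist1_le_two_specialUnitaryGroup`). [cite: Balaban1985UV3, (7) p.257] -/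
theorem perPlaquette_offSliver (hγ : 0 < γ) {D R αR cR CR αX cX CX : ℝ} {AR AX : ℕ} (hD : 1 ≤ D) (hR : 2 ≤ R)
    (hαR : 0 < αR) (hcR : 0 < cR) (hCR : 0 ≤ CR) (hCX : 0 ≤ CX)
    (hRR : ∀ (K a b : ℕ) (x : Site (F.P K) 0) (μ ν : Fin (F.P K).d) (t : ℝ), μ ≠ ν → 1 ≤ a → 1 ≤ b →
      2 * (a + b) < (F.P K).sitesPerDir 0 → 0 < t → t ≤ 1 →
        (gibbsK F ℰp γ K).real {U | t ≤ GaugeGroup.dist1 (Missing.pathHol U (Missing.rectLoop x μ ν a b))} ≤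
          CR * (F.scheme ℰp γ).β K ^ AR * ((a : ℝ) + b) ^ AR *
            Real.exp (-((cR * (t ^ 2 * (F.scheme ℰp γ).β K / (((a : ℝ) + b) * (1 + Real.log ((a : ℝ) + b))))) ^ αR)))
    (hXX : ∀ (K j : ℕ) (q : Plaq (F.P K) j) (η : ℝ), j ≤ K → 0 < η → η ≤ 1 →
      (gibbsK F ℰp γ K).real {U | (∀ (i a b : ℕ) (x : Site (F.P K) 0) (μ ν : Fin (F.P K).d), μ ≠ ν → i ≤ j → 1 ≤ a → 1 ≤ b →
          2 * (a + b) < (F.P K).sitesPerDir 0 → ((a : ℝ) + b) ≤ R * (F.L : ℝ) ^ i →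
            GaugeGroup.dist1 (Missing.pathHol U (Missing.rectLoop x μ ν a b)) ≤ η * Real.sqrt ((F.L : ℝ) ^ i / (F.L : ℝ) ^ j)) ∧
          D * ((j : ℝ) + 1) * η < GaugeGroup.dist1 (GaugeField.plaqHol
            (Averaging.iter (fun i => BlockAveraging.blockAvg (P := F.P K) (j := i) ℰp) j U) q)} ≤
        CX * (F.scheme ℰp γ).β K ^ AX * Real.exp (-((cX * (η / (γ * ((F.L : ℝ)⁻¹) ^ (K - j)))) ^ αX)))
    (K j : ℕ) (hjK : j ≤ K) (q : Plaq (F.P K) j) {θ : ℝ} (hθ : 0 < θ) :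
    (gibbsK F ℰp γ K).real {U | θ ≤ GaugeGroup.dist1 (GaugeField.plaqHol
        (Averaging.iter (fun i => BlockAveraging.blockAvg (P := F.P K) (j := i) ℰp) j U) q)} ≤
      (((j : ℝ) + 1) * ((⌊R * (F.L : ℝ) ^ j⌋₊ : ℝ) + 1) ^ 2 * (((F.P K).sitesPerDir 0 : ℝ)) ^ 3 * 9) *
          (CR * (F.scheme ℰp γ).β K ^ AR * (R * (F.L : ℝ) ^ j) ^ AR *
            Real.exp (-((cR * ((θ / (2 * D * ((j : ℝ) + 1))) ^ 2 * (F.scheme ℰp γ).β K /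
              (R * (F.L : ℝ) ^ j * (1 + Real.log (R * (F.L : ℝ) ^ j))))) ^ αR))) +
        CX * (F.scheme ℰp γ).β K ^ AX *
          Real.exp (-((cX * ((θ / (2 * D * ((j : ℝ) + 1))) / (γ * ((F.L : ℝ)⁻¹) ^ (K - j)))) ^ αX)) := by
  haveI := isProbabilityMeasure_gibbsK F ℰp hγ.le K
  have hβ0 : 0 ≤ (F.scheme ℰp γ).β K := F.scheme_β_nonneg ℰp hγ.le K
  have hL1 : (1 : ℝ) ≤ F.L := by exact_mod_cast F.hL.2.le
  set η : ℝ := θ / (2 * D * ((j : ℝ) + 1)) with hη_def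
  have hj1 : (1 : ℝ) ≤ (j : ℝ) + 1 := by have : (0:ℝ) ≤ j := Nat.cast_nonneg j; linarith
  have hden : 0 < 2 * D * ((j : ℝ) + 1) := by positivity
  have hη0 : 0 < η := div_pos hθ hden
  have hDη : D * ((j : ℝ) + 1) * η = θ / 2 := by rw [hη_def]; field_simp
  -- both right-hand terms are non-negative
  have hT1 : 0 ≤ (((j : ℝ) + 1) * ((⌊R * (F.L : ℝ) ^ j⌋₊ : ℝ) + 1) ^ 2 * (((F.P K).sitesPerDir 0 : ℝ)) ^ 3 * 9) *
      (CR * (F.scheme ℰp γ).β K ^ AR * (R * (F.L : ℝ) ^ j) ^ AR *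
        Real.exp (-((cR * (η ^ 2 * (F.scheme ℰp γ).β K / (R * (F.L : ℝ) ^ j * (1 + Real.log (R * (F.L : ℝ) ^ j))))) ^ αR))) := by
    have : 0 ≤ R * (F.L : ℝ) ^ j := by positivity
    positivity
  have hT2 : 0 ≤ CX * (F.scheme ℰp γ).β K ^ AX * Real.exp (-((cX * (η / (γ * ((F.L : ℝ)⁻¹) ^ (K - j)))) ^ αX)) := by
    positivity
  by_cases hθ2 : θ ≤ 2
  · -- `η ≤ 1`
    have hη1 : η ≤ 1 := by
      rw [hη_def, div_le_one hden]
      nlinarith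
    -- the inclusion
    have hsub : {U : GaugeField (F.P K) 0 (Matrix.specialUnitaryGroup (Fin 2) ℂ) | θ ≤ GaugeGroup.dist1 (GaugeField.plaqHol
          (Averaging.iter (fun i => BlockAveraging.blockAvg (P := F.P K) (j := i) ℰp) j U) q)} ⊆
        {U | ¬ (∀ (i a b : ℕ) (x : Site (F.P K) 0) (μ ν : Fin (F.P K).d), μ ≠ ν → i ≤ j → 1 ≤ a → 1 ≤ b →
            2 * (a + b) < (F.P K).sitesPerDir 0 → ((a : ℝ) + b) ≤ R * (F.L : ℝ) ^ i →
              GaugeGroup.dist1 (Missing.pathHol U (Missing.rectLoop x μ ν a b)) ≤ η * Real.sqrt ((F.L : ℝ) ^ i / (F.L : ℝ) ^ j))} ∪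
        {U | (∀ (i a b : ℕ) (x : Site (F.P K) 0) (μ ν : Fin (F.P K).d), μ ≠ ν → i ≤ j → 1 ≤ a → 1 ≤ b →
            2 * (a + b) < (F.P K).sitesPerDir 0 → ((a : ℝ) + b) ≤ R * (F.L : ℝ) ^ i →
              GaugeGroup.dist1 (Missing.pathHol U (Missing.rectLoop x μ ν a b)) ≤ η * Real.sqrt ((F.L : ℝ) ^ i / (F.L : ℝ) ^ j)) ∧
            D * ((j : ℝ) + 1) * η < GaugeGroup.dist1 (GaugeField.plaqHol
              (Averaging.iter (fun i => BlockAveraging.blockAvg (P := F.P K) (j := i) ℰp) j U) q)} := by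
      intro U hU
      by_cases hflat : ∀ (i a b : ℕ) (x : Site (F.P K) 0) (μ ν : Fin (F.P K).d), μ ≠ ν → i ≤ j → 1 ≤ a → 1 ≤ b →
          2 * (a + b) < (F.P K).sitesPerDir 0 → ((a : ℝ) + b) ≤ R * (F.L : ℝ) ^ i →
            GaugeGroup.dist1 (Missing.pathHol U (Missing.rectLoop x μ ν a b)) ≤ η * Real.sqrt ((F.L : ℝ) ^ i / (F.L : ℝ) ^ j)
      · right
        refine ⟨hflat, ?_⟩
        rw [hDη]
        have : θ ≤ GaugeGroup.dist1 (GaugeField.plaqHol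
          (Averaging.iter (fun i => BlockAveraging.blockAvg (P := F.P K) (j := i) ℰp) j U) q) := hU
        linarith
      · left; exact hflat
    calc (gibbsK F ℰp γ K).real {U | θ ≤ GaugeGroup.dist1 (GaugeField.plaqHol
            (Averaging.iter (fun i => BlockAveraging.blockAvg (P := F.P K) (j := i) ℰp) j U) q)}
        ≤ (gibbsK F ℰp γ K).real ({U | ¬ (∀ (i a b : ℕ) (x : Site (F.P K) 0) (μ ν : Fin (F.P K).d), μ ≠ ν → i ≤ j → 1 ≤ a → 1 ≤ b →
              2 * (a + b) < (F.P K).sitesPerDir 0 → ((a : ℝ) + b) ≤ R * (F.L : ℝ) ^ i →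
                GaugeGroup.dist1 (Missing.pathHol U (Missing.rectLoop x μ ν a b)) ≤ η * Real.sqrt ((F.L : ℝ) ^ i / (F.L : ℝ) ^ j))} ∪
            {U | (∀ (i a b : ℕ) (x : Site (F.P K) 0) (μ ν : Fin (F.P K).d), μ ≠ ν → i ≤ j → 1 ≤ a → 1 ≤ b →
              2 * (a + b) < (F.P K).sitesPerDir 0 → ((a : ℝ) + b) ≤ R * (F.L : ℝ) ^ i →
                GaugeGroup.dist1 (Missing.pathHol U (Missing.rectLoop x μ ν a b)) ≤ η * Real.sqrt ((F.L : ℝ) ^ i / (F.L : ℝ) ^ j)) ∧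
              D * ((j : ℝ) + 1) * η < GaugeGroup.dist1 (GaugeField.plaqHol
                (Averaging.iter (fun i => BlockAveraging.blockAvg (P := F.P K) (j := i) ℰp) j U) q)}) :=
          measureReal_mono hsub (measure_ne_top _ _)
      _ ≤ _ := (measureReal_union_le _ _).trans
          (add_le_add (not_flat_le hγ hR hαR hcR hCR hRR K j hη0 hη1) (hXX K j q η hjK hη0 hη1))
  · -- `θ > 2`: the event is empty
    rw [not_le] at hθ2
    have hempty : {U : GaugeField (F.P K) 0 (Matrix.specialUnitaryGroup (Fin 2) ℂ) | θ ≤ GaugeGroup.dist1 (GaugeField.plaqHol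
          (Averaging.iter (fun i => BlockAveraging.blockAvg (P := F.P K) (j := i) ℰp) j U) q)} = ∅ :=
      Set.eq_empty_of_forall_notMem fun U hU =>
        absurd ((show θ ≤ _ from hU).trans (T4PairDerivBridge.dist1_le_two_specialUnitaryGroup _)) (not_le.mpr hθ2)
    rw [hempty, measureReal_empty]
    exact add_nonneg hT1 hT2

end Summit.QuantumFields.YangMills.Theorems.RandomisedStokesOffSliver

end
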